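import Mathlib
import HarnessLib
import Summits.NavierStokesRegularity.NavierStokesRegularity.Theorems.PoloidalWindowDoorLrcModEntireSheetSystemMixed
import Summits.NavierStokesRegularity.NavierStokesRegularity.Theorems.PoloidalWindowDoorLrcModEntireShearedVerticalRow
import Summits.NavierStokesRegularity.NavierStokesRegularity.Theorems.PoloidalWindowDoorLrcModEntireShearedTemplateCoeffs
import Summits.NavierStokesRegularity.NavierStokesRegularity.Theorems.PoloidalWindowDoorLrcModEntireSheetCauchyData
import Summits.NavierStokesRegularity.NavierStokesRegularity.Theorems.PoloidalWindowDoorLrcModEntireHorizontalGermAtTime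

/-!
# Route `PoloidalWindowDoor`, item `LrcModEntire` (stmt-NavierStokesRegularity-20428), cell (Q4-sonic), slot `stub_Q4sonicLineNeg` —
# CASE I, s-FREE BRANCH: the sheared mixed system + vanishing sheet data force `∂_eU₂ ≡ 0` near the web sheet, hence `False`

Cell ns-regularity-ideate, helper seat ns-k2-port-2 g8 under the LEAD of item 20428 (ns-poloidal-K2-p3 g17, memo `T2B-g17.md` v4 §7 A-I, steps S4–S5 for the s-free
branch); `--supports stmt-NavierStokesRegularity-20428 --as helper`.

ASSEMBLY (all inputs by name): the LEAD's Cauchy–Kovalevskaya template `…SheetSystemMixed.eq_zero_of_mixedSystem_template` applied to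
`g = gST (uncurry U) e ∘ Φ`, `P = PST … ∘ Φ`, `Q = QST … ∘ Φ` (Φ = the moving shear with offset `d(t,z) = n₀(t+1,0,z)`), with rows hR1/hR2 = `…ShearedKinematics`,
hR3 = `…ShearedVerticalRow.verticalRow_template`, coefficient smoothness = `…ShearedTemplateCoeffs.template_coeffs_smooth`, data `g = ∂_mg = 0` =
`…SheetCauchyData.cauchyData_g_of_package`, smoothness/analyticity of `g,P,Q` = `…ShearedCoordinates` / `…ShearedKinematics`; endgame = K2-p2's
`…HorizontalGermAtTime.false_of_local_horizontalDeriv_two_eq_zero_at`.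
* ★★ `caseI_sfree_g_eq_zero` — HYPOTHESES: class profile (poloidal, `U₂(−1,0) ≠ 0`), (TH) slab law (`C³` slope literal) + the output block of
  `…Q4TimeWebPackage.time_web_package_line` (`δ′, n₀, κ`) + CASE I on the box (`hsonI`: `R(τ,·)` affine for `|τ| < δ′`; `hparI`: webs parallel, K2-p2's S1) + an open
  parameter set `O` inside the box on which the slope is smooth and `≠ 1` (`hμs`, `hμ1`; dischargeable by `…SlopeSmooth`) + **the s-FREE SHEET DATA `P = Q = 0` on `{m=0}`
  over `O`** (S3(e), LEAD `…SheetDataRigidity`) ⊢ `g ≡ 0` on the tube over `O`.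
* ★★★ `caseI_sfree_false` — the same hypotheses with `O` non-empty ⊢ `False` (the tube at a time `t₀` covers an open set of `ℝ³`, so `∂_eU₂(t₀,·)` vanishes on an open set).
So the s-free sub-branch of case I of `stub_Q4sonicLineNeg` is CLOSED MODULO its two analytic inputs (sheet data from S3(e); slope smoothness on the box), both of
which have bricks in the tree.  WHAT THIS IS NOT: not a claim about Navier–Stokes regularity and not a registry stub: a conditional closure of one sub-branch of one research
slot; `stub_Q4sonicLineNeg` / ⟨20428⟩ / ⟨19708⟩ / ⟨27893⟩ OPEN.
-/

noncomputable section

set_option linter.dupNamespace false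
set_option linter.style.longLine false

namespace Summit.NavierStokesRegularity.NavierStokesRegularity.Theorems.PoloidalWindowDoorLrcModEntireCaseISfreeBranch

open Set Function Filter Topology Metric
open scoped RealInnerProductSpace InnerProductSpace ContDiff
open Literature.Analysis
open Summit.NavierStokesRegularity.NavierStokesRegularity.Theorems.LocalSineTubeDoorProfileAlignedWindowRigidityAncient
open Summit.NavierStokesRegularity.NavierStokesRegularity.Theorems.PoloidalWindowDoorPoloidalWindowRigidityWindow
open Summit.NavierStokesRegularity.NavierStokesRegularity.Theorems.PoloidalWindowDoorLrcModEntireSheetSystemUniqueness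
open Summit.NavierStokesRegularity.NavierStokesRegularity.Theorems.PoloidalWindowDoorLrcModEntireSheetSystemMixed
open Summit.NavierStokesRegularity.NavierStokesRegularity.Theorems.PoloidalWindowDoorLrcModEntireSheetFlattenTools
open Summit.NavierStokesRegularity.NavierStokesRegularity.Theorems.PoloidalWindowDoorLrcModEntireShearedCoordinates
open Summit.NavierStokesRegularity.NavierStokesRegularity.Theorems.PoloidalWindowDoorLrcModEntireShearedKinematics
open Summit.NavierStokesRegularity.NavierStokesRegularity.Theorems.PoloidalWindowDoorLrcModEntireShearedSecondOrder
open Summit.NavierStokesRegularity.NavierStokesRegularity.Theorems.PoloidalWindowDoorLrcModEntireShearedVerticalRow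
open Summit.NavierStokesRegularity.NavierStokesRegularity.Theorems.PoloidalWindowDoorLrcModEntireShearedTemplateCoeffs
open Summit.NavierStokesRegularity.NavierStokesRegularity.Theorems.PoloidalWindowDoorLrcModEntireSheetCauchyData
open Summit.NavierStokesRegularity.NavierStokesRegularity.Theorems.PoloidalWindowDoorLrcModEntireHorizontalGermAtTime
open Summit.NavierStokesRegularity.NavierStokesRegularity.Theorems.PoloidalWindowDoorLrcModEntireQ4SonicHotSheetJet

variable {C : ℝ} {U : ℝ → E3 → E3} {R μ : ℝ → ℝ → ℝ} {σ r ρ δ' : ℝ} {e : E3} {n₀ : ℝ × ℝ × ℝ → ℝ} {κt : ℝ → ℝ → ℝ}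
  {O : Set Y3} {Dμ : Set (ℝ × ℝ)}

/-- ★★ **CASE I, s-FREE BRANCH: `g = ∂_eU₂ ∘ Φ ≡ 0` on the tube.**  See the module docstring. -/
theorem caseI_sfree_g_eq_zero
    (hrate : FluidPDE.HasTypeITimeDecay C U) (hcont : ContinuousOn (uncurry U) (Iio (0 : ℝ) ×ˢ univ))
    (hmild : ∀ s t : ℝ, s < t → t < 0 → ∀ x, U t x = UnboundedOperators.heatExtension (U s) (t - s) x - FluidPDE.oseenDuhamel 1 s U U t x)
    (hdiv : ∀ t < 0, FluidPDE.VectorCalculus.IsDivFree (U t))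
    (hpol : ∀ s < 0, ∀ y, ⟪FluidPDE.curl (U s) y, EuclideanSpace.single 2 1⟫_ℝ = 0)
    (hσ : σ = 1 ∨ σ = -1) (hμ3 : ContDiff ℝ 3 (uncurry μ))
    (hslabU : ∀ t : ℝ, |t + 1| < ρ → ∀ x : E3, |x 2| < ρ → ∀ b : Fin 3, b ≠ 2 →
      fderiv ℝ (U t) x (EuclideanSpace.single 2 1) b = μ t (x 2) * fderiv ℝ (U t) x (EuclideanSpace.single b 1) 2)
    (hδ'ρ : δ' ≤ ρ) (hδ'h : δ' < 1 / 2) (he2 : e 2 = 0) (hunit : e 0 ^ 2 + e 1 ^ 2 = 1)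
    (hpack : ∀ q : ℝ × ℝ × ℝ, |q.1| < δ' → |q.2.2| < δ' →
        n₀ q ∈ Ioo (-r) r ∧
        σ * U (-1 + q.1) (frameCLM e (q.2.1, n₀ q, q.2.2)) 2 = R q.1 q.2.2 ∧
        (∀ n ∈ Icc (-r) r, n ≠ n₀ q → σ * U (-1 + q.1) (frameCLM e (q.2.1, n, q.2.2)) 2 < R q.1 q.2.2) ∧
        (∀ w : E3, w 2 = 0 → fderiv ℝ (fun y => U (-1 + q.1) y 2) (frameCLM e (q.2.1, n₀ q, q.2.2)) w = 0) ∧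
        (∀ m : ℕ∞, ContDiffAt ℝ m n₀ q) ∧
        0 < κt q.1 q.2.2 ∧
        fderiv ℝ (fderiv ℝ (fun y => σ * U (-1 + q.1) y 2)) (frameCLM e (q.2.1, n₀ q, q.2.2)) e e +
            fderiv ℝ (fderiv ℝ (fun y => σ * U (-1 + q.1) y 2)) (frameCLM e (q.2.1, n₀ q, q.2.2)) (Jvec e) (Jvec e) =
          -κt q.1 q.2.2 ∧
        κt q.1 q.2.2 * (fderiv ℝ n₀ q ((0 : ℝ), (0 : ℝ), (1 : ℝ))) ^ 2 =
          (deriv (deriv (R q.1)) q.2.2 - μ (-1 + q.1) q.2.2 * κt q.1 q.2.2) * (1 + (fderiv ℝ n₀ q ((0 : ℝ), (1 : ℝ), (0 : ℝ))) ^ 2))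
    (hsonI : ∀ τ : ℝ, |τ| < δ' → ∃ A B : ℝ, ∀ z : ℝ, |z| < δ' → R τ z = A + B * z)
    (hparI : ∀ τ s z : ℝ, |τ| < δ' → |z| < δ' → n₀ (τ, s, z) = n₀ (τ, (0 : ℝ), z))
    (hO : IsOpen O) (hObox : ∀ y ∈ O, |y.1 + 1| < δ' ∧ |y.2.2| < δ')
    (hDμ : IsOpen Dμ) (hμs : ContDiffOn ℝ ∞ (uncurry μ) Dμ) (hOμ : ∀ y ∈ O, (y.1, y.2.2) ∈ Dμ) (hμ1 : ∀ y ∈ O, μ y.1 y.2.2 ≠ 1)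
    (hP0 : ∀ y ∈ O, (PST (uncurry U) e ∘ shearMap e (fun q : ℝ × ℝ => n₀ (q.1 + 1, (0 : ℝ), q.2))) (y, 0) = 0)
    (hQ0 : ∀ y ∈ O, (QST (uncurry U) e ∘ shearMap e (fun q : ℝ × ℝ => n₀ (q.1 + 1, (0 : ℝ), q.2))) (y, 0) = 0)
    {y : Y3} (hy : y ∈ O) (m : ℝ) :
    (gST (uncurry U) e ∘ shearMap e (fun q : ℝ × ℝ => n₀ (q.1 + 1, (0 : ℝ), q.2))) (y, m) = 0 := by
  set d : ℝ × ℝ → ℝ := fun q => n₀ (q.1 + 1, (0 : ℝ), q.2) with hd_def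
  -- the parameter box for `d` and the time range
  set D : Set (ℝ × ℝ) := {q | |q.1 + 1| < δ' ∧ |q.2| < δ'} with hD_def
  have hD : IsOpen D := by
    refine IsOpen.and ?_ ?_
    · exact isOpen_lt (continuous_abs.comp (continuous_fst.add continuous_const)) continuous_const
    · exact isOpen_lt (continuous_abs.comp continuous_snd) continuous_const
  have hd : ContDiffOn ℝ ∞ d D := by
    intro q hq
    obtain ⟨-, -, -, -, hnC, -, -, -⟩ := hpack (q.1 + 1, (0 : ℝ), q.2) hq.1 hq.2
    have hline : ContDiff ℝ ∞ (fun q' : ℝ × ℝ => ((q'.1 + 1, (0 : ℝ), q'.2) : ℝ × ℝ × ℝ)) :=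
      (contDiff_fst.add contDiff_const).prodMk (contDiff_const.prodMk contDiff_snd)
    have h1 : ContDiffAt ℝ ∞ n₀ ((fun q' : ℝ × ℝ => ((q'.1 + 1, (0 : ℝ), q'.2) : ℝ × ℝ × ℝ)) q) := by simpa using hnC ⊤
    exact (h1.comp q hline.contDiffAt).contDiffWithinAt
  have hOD : ∀ y ∈ O, (y.1, y.2.2) ∈ D := fun y hy => hObox y hy
  set T : Set ℝ := Iio 0 with hT_def
  have hT : IsOpen T := isOpen_Iio
  have hOT : ∀ y ∈ O, y.1 ∈ T := fun y hy => by
    have h := (abs_lt.1 (hObox y hy).1).2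
    show y.1 < 0; linarith [hδ'h]
  have hOt : ∀ y ∈ O, y.1 < 0 ∧ |y.1 + 1| < ρ ∧ |y.2.2| < ρ := fun y hy =>
    ⟨hOT y hy, lt_of_lt_of_le (hObox y hy).1 hδ'ρ, lt_of_lt_of_le (hObox y hy).2 hδ'ρ⟩
  have hA := isTypeIAncientMild_of_class hrate hcont hmild hdiv
  have hW : ContDiffOn ℝ ∞ (uncurry U) (T ×ˢ (univ : Set E3)) := hA.contDiffOn
  -- smoothness of `g, P, Q` on the tube and analyticity of `g` along normal lines
  obtain ⟨hg, hP, hQ⟩ := contDiffOn_gPQ (e := e) hT hW hOT hD hd hOD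
  have hWan : ∀ t ∈ T, AnalyticOnNhd ℝ (fun x : E3 => uncurry U (t, x)) univ := fun t ht =>
    analyticOnNhd_slice hcont (bdd_of_hasTypeITimeDecay hrate) hmild ht
  have hgan : ∀ y ∈ O, AnalyticOnNhd ℝ (fun r : ℝ => (gST (uncurry U) e ∘ shearMap e d) (y, r)) univ := fun y hy =>
    analyticOnNhd_normalLine_comp_shearMap (fun t ht => (analyticOnNhd_slices (e := e) hT hW hWan ht).1) hOT hy
  -- the coefficients
  obtain ⟨hdz, hα₂, hα₃, hα₄, hα₅, hα₆, hα₇, hα₈⟩ := template_coeffs_smooth (e := e) hT hW hOT hDμ hμs hOμ hμ1 hD hd hOD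
  have hα₁ : ContDiffOn ℝ ∞ (fun _ : Y3 × ℝ => (-1 : ℝ)) (tube O) := contDiffOn_const
  -- the three rows
  have hR1 : ∀ p ∈ tube O, pd dN (PST (uncurry U) e ∘ shearMap e d) p = pd (tg eS) (QST (uncurry U) e ∘ shearMap e d) p :=
    fun p hp => pd_dN_PST_eq hT hW (fun t ht x => by
      have h := hpol t ht x; rwa [EuclideanSpace.inner_single_right, one_mul] at h) he2 hOT hD hd hOD hp
  have hR2 : ∀ p ∈ tube O, pd dN (QST (uncurry U) e ∘ shearMap e d) p =
      -pd (tg eS) (PST (uncurry U) e ∘ shearMap e d) p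
        - (pd (tg PoloidalWindowDoorLrcModEntireShearedCoordinates.eZ) (gST (uncurry U) e ∘ shearMap e d) p
            - fderiv ℝ d (p.1.1, p.1.2.2) ((0 : ℝ), (1 : ℝ)) * pd dN (gST (uncurry U) e ∘ shearMap e d) p) :=
    fun p hp => pd_dN_QST_eq hT hW (fun t ht => hdiv t ht) he2 hunit hOT hD hd hOD hp
  have hR3 := fun p (hp : p ∈ tube O) =>
    verticalRow_template (e := e) (d := d) hrate hcont hmild hdiv hpol hμ3 hslabU he2 hunit hO hOt hμ1 hD hd hOD hp
  -- the Cauchy data of `g`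
  have hg0 : ∀ y ∈ O, (gST (uncurry U) e ∘ shearMap e d) (y, 0) = 0 := fun y hy =>
    (cauchyData_g_of_package hrate hcont hmild hdiv hσ hμ3 hslabU hδ'ρ hδ'h he2 hunit hpack hsonI hparI (hObox y hy).1 (hObox y hy).2).1
  have hg1 : ∀ y ∈ O, pd dN (gST (uncurry U) e ∘ shearMap e d) (y, 0) = 0 := fun y hy =>
    (cauchyData_g_of_package hrate hcont hmild hdiv hσ hμ3 hslabU hδ'ρ hδ'h he2 hunit hpack hsonI hparI (hObox y hy).1 (hObox y hy).2).2
  exact eq_zero_of_mixedSystem_template hO hg hP hQ hgan eS eT PoloidalWindowDoorLrcModEntireShearedCoordinates.eZ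
    hdz hα₁ hα₂ hα₃ hα₄ hα₅ hα₆ hα₇ hα₈ hR1 hR2 hR3 hg0 hg1 hP0 hQ0 hy m

/-- ★★★ **CASE I, s-FREE BRANCH ⇒ `False`.**  Under the hypotheses of `caseI_sfree_g_eq_zero` with `O` non-empty and the hot value `U₂(−1,0) ≠ 0`:
at a time `t₀` of `O` the tube covers an open set of `ℝ³` on which `∂_eU₂(t₀,·) = 0`, and K2-p2's `…HorizontalGermAtTime.false_of_local_horizontalDeriv_two_eq_zero_at`
(analytic propagation + the horizontal-germ Liouville endgame) empties the profile. -/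
theorem caseI_sfree_false
    (hrate : FluidPDE.HasTypeITimeDecay C U) (hcont : ContinuousOn (uncurry U) (Iio (0 : ℝ) ×ˢ univ))
    (hmild : ∀ s t : ℝ, s < t → t < 0 → ∀ x, U t x = UnboundedOperators.heatExtension (U s) (t - s) x - FluidPDE.oseenDuhamel 1 s U U t x)
    (hdiv : ∀ t < 0, FluidPDE.VectorCalculus.IsDivFree (U t))
    (hpol : ∀ s < 0, ∀ y, ⟪FluidPDE.curl (U s) y, EuclideanSpace.single 2 1⟫_ℝ = 0)
    (hUne : U (-1) 0 2 ≠ 0)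
    (hσ : σ = 1 ∨ σ = -1) (hμ3 : ContDiff ℝ 3 (uncurry μ))
    (hslabU : ∀ t : ℝ, |t + 1| < ρ → ∀ x : E3, |x 2| < ρ → ∀ b : Fin 3, b ≠ 2 →
      fderiv ℝ (U t) x (EuclideanSpace.single 2 1) b = μ t (x 2) * fderiv ℝ (U t) x (EuclideanSpace.single b 1) 2)
    (hδ'ρ : δ' ≤ ρ) (hδ'h : δ' < 1 / 2) (he2 : e 2 = 0) (hunit : e 0 ^ 2 + e 1 ^ 2 = 1)
    (hpack : ∀ q : ℝ × ℝ × ℝ, |q.1| < δ' → |q.2.2| < δ' →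
        n₀ q ∈ Ioo (-r) r ∧
        σ * U (-1 + q.1) (frameCLM e (q.2.1, n₀ q, q.2.2)) 2 = R q.1 q.2.2 ∧
        (∀ n ∈ Icc (-r) r, n ≠ n₀ q → σ * U (-1 + q.1) (frameCLM e (q.2.1, n, q.2.2)) 2 < R q.1 q.2.2) ∧
        (∀ w : E3, w 2 = 0 → fderiv ℝ (fun y => U (-1 + q.1) y 2) (frameCLM e (q.2.1, n₀ q, q.2.2)) w = 0) ∧
        (∀ m : ℕ∞, ContDiffAt ℝ m n₀ q) ∧
        0 < κt q.1 q.2.2 ∧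
        fderiv ℝ (fderiv ℝ (fun y => σ * U (-1 + q.1) y 2)) (frameCLM e (q.2.1, n₀ q, q.2.2)) e e +
            fderiv ℝ (fderiv ℝ (fun y => σ * U (-1 + q.1) y 2)) (frameCLM e (q.2.1, n₀ q, q.2.2)) (Jvec e) (Jvec e) =
          -κt q.1 q.2.2 ∧
        κt q.1 q.2.2 * (fderiv ℝ n₀ q ((0 : ℝ), (0 : ℝ), (1 : ℝ))) ^ 2 =
          (deriv (deriv (R q.1)) q.2.2 - μ (-1 + q.1) q.2.2 * κt q.1 q.2.2) * (1 + (fderiv ℝ n₀ q ((0 : ℝ), (1 : ℝ), (0 : ℝ))) ^ 2))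
    (hsonI : ∀ τ : ℝ, |τ| < δ' → ∃ A B : ℝ, ∀ z : ℝ, |z| < δ' → R τ z = A + B * z)
    (hparI : ∀ τ s z : ℝ, |τ| < δ' → |z| < δ' → n₀ (τ, s, z) = n₀ (τ, (0 : ℝ), z))
    (hO : IsOpen O) (hOne : O.Nonempty) (hObox : ∀ y ∈ O, |y.1 + 1| < δ' ∧ |y.2.2| < δ')
    (hDμ : IsOpen Dμ) (hμs : ContDiffOn ℝ ∞ (uncurry μ) Dμ) (hOμ : ∀ y ∈ O, (y.1, y.2.2) ∈ Dμ) (hμ1 : ∀ y ∈ O, μ y.1 y.2.2 ≠ 1)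
    (hP0 : ∀ y ∈ O, (PST (uncurry U) e ∘ shearMap e (fun q : ℝ × ℝ => n₀ (q.1 + 1, (0 : ℝ), q.2))) (y, 0) = 0)
    (hQ0 : ∀ y ∈ O, (QST (uncurry U) e ∘ shearMap e (fun q : ℝ × ℝ => n₀ (q.1 + 1, (0 : ℝ), q.2))) (y, 0) = 0) :
    False := by
  set d : ℝ × ℝ → ℝ := fun q => n₀ (q.1 + 1, (0 : ℝ), q.2) with hd_def
  obtain ⟨y₀, hy₀⟩ := hOne
  set t₀ : ℝ := y₀.1 with ht₀_def
  have ht₀1 : |t₀ + 1| < δ' := (hObox y₀ hy₀).1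
  have hδ' : 0 < δ' := lt_of_le_of_lt (abs_nonneg _) ht₀1
  have hρ : 0 < ρ := lt_of_lt_of_le hδ' hδ'ρ
  have ht₀ρ : |t₀ + 1| < ρ := lt_of_lt_of_le ht₀1 hδ'ρ
  have ht₀ : t₀ < 0 := by have h := (abs_lt.1 ht₀1).2; linarith [hδ'h]
  have he : e ≠ 0 := by
    intro h0
    rw [h0] at hunit
    simp at hunit
  -- the open set covered by the tube at time `t₀`
  set ι : E3 → Y3 := fun x => (t₀, x 0 * e 0 + x 1 * e 1, x 2) with hι
  have hιc : Continuous ι := by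
    refine continuous_const.prodMk ((Continuous.add ?_ ?_).prodMk ?_)
    · exact ((EuclideanSpace.proj (𝕜 := ℝ) (0 : Fin 3)).continuous).mul continuous_const
    · exact ((EuclideanSpace.proj (𝕜 := ℝ) (1 : Fin 3)).continuous).mul continuous_const
    · exact (EuclideanSpace.proj (𝕜 := ℝ) (2 : Fin 3)).continuous
  set V : Set E3 := ι ⁻¹' O with hV_def
  have hV : IsOpen V := hO.preimage hιc
  -- the web point over `y₀` lies in `V`
  have hsq : e 0 * e 0 + e 1 * e 1 = 1 := by nlinarith [hunit]
  have hVne : V.Nonempty := by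
    refine ⟨shearPt e d (y₀, 0), ?_⟩
    show ι (shearPt e d (y₀, 0)) ∈ O
    have hcomp : ∀ i : Fin 3, (shearPt e d (y₀, 0)) i = y₀.2.1 * e i + (0 + d (y₀.1, y₀.2.2)) * (Jvec e) i + y₀.2.2 * e2 i :=
      fun i => by simp [shearPt]
    have hJ0 : (Jvec e) 0 = -(e 1) := by simp [Jvec]
    have hJ1 : (Jvec e) 1 = e 0 := by simp [Jvec]
    have hJ2 : (Jvec e) 2 = 0 := by simp [Jvec]
    have hE0 : e2 0 = 0 := by simp [e2]
    have hE1 : e2 1 = 0 := by simp [e2]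
    have hE2 : e2 2 = 1 := by simp [e2]
    have h1 : ι (shearPt e d (y₀, 0)) = y₀ := by
      refine Prod.ext rfl (Prod.ext ?_ ?_)
      · show (shearPt e d (y₀, 0)) 0 * e 0 + (shearPt e d (y₀, 0)) 1 * e 1 = y₀.2.1
        rw [hcomp 0, hcomp 1, hJ0, hJ1, hE0, hE1]
        linear_combination y₀.2.1 * hsq
      · show (shearPt e d (y₀, 0)) 2 = y₀.2.2
        rw [hcomp 2, hJ2, hE2, he2]; ring
    rw [h1]; exact hy₀
  -- `∂_eU₂(t₀,·) = 0` on `V`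
  have hA := isTypeIAncientMild_of_class hrate hcont hmild hdiv
  have hW : ContDiffOn ℝ ∞ (uncurry U) (Iio 0 ×ˢ (univ : Set E3)) := hA.contDiffOn
  have hsl : ContDiff ℝ ∞ (U t₀) := hA.contDiff_slice ht₀
  have hUd : Differentiable ℝ (U t₀) := hsl.differentiable (by simp)
  have hη : ∀ x ∈ V, fderiv ℝ (fun y => U t₀ y 2) x e = 0 := by
    intro x hx
    have hyO : ι x ∈ O := hx
    set m : ℝ := (x 1 * e 0 - x 0 * e 1) - d (t₀, x 2) with hm
    have hg := caseI_sfree_g_eq_zero hrate hcont hmild hdiv hpol hσ hμ3 hslabU hδ'ρ hδ'h he2 hunit hpack hsonI hparI hO hObox hDμ hμs hOμ hμ1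
      hP0 hQ0 hyO m
    have hpt : shearPt e d (ι x, m) = x := by
      have h0 : shearPt e d (ι x, m) = (x 0 * e 0 + x 1 * e 1) • e + (m + d (t₀, x 2)) • Jvec e + x 2 • e2 := rfl
      rw [h0, show m + d (t₀, x 2) = x 1 * e 0 - x 0 * e 1 by rw [hm]; ring]
      exact (frame_decomp he2 hunit x).symm
    have hΦ : shearMap e d (ι x, m) = (t₀, x) := by
      show ((ι x).1, shearPt e d (ι x, m)) = (t₀, x)
      rw [hpt]
    have h1 : gST (uncurry U) e (t₀, x) = 0 := by
      have h := hg
      simp only [Function.comp_apply] at h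
      rw [hΦ] at h
      exact h
    rw [gST_slice isOpen_Iio hW ht₀ x] at h1
    have hcoord : fderiv ℝ (U t₀) x e 2 = fderiv ℝ (fun y : E3 => U t₀ y 2) x e := by
      have h := ((EuclideanSpace.proj (𝕜 := ℝ) (2 : Fin 3)).hasFDerivAt.comp x (hUd x).hasFDerivAt).fderiv
      have e3 : (⇑(EuclideanSpace.proj (𝕜 := ℝ) (2 : Fin 3)) ∘ U t₀) = fun y => U t₀ y 2 := by funext y; simp
      rw [e3] at h
      rw [h]; rfl
    rw [← hcoord]
    exact h1
  exact false_of_local_horizontalDeriv_two_eq_zero_at hrate hcont hmild hdiv hpol ht₀ hρ ht₀ρ hslabU he he2 hV hVne hη hUne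

end Summit.NavierStokesRegularity.NavierStokesRegularity.Theorems.PoloidalWindowDoorLrcModEntireCaseISfreeBranch
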